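import Literature.NumberTheory.EllipticCurves.TianYuanZhang2017.GenusDescentDefs
import Literature.NumberTheory.EllipticCurves.IsogenyLocalPointsMaps
import HarnessLib

/-!
# The congruent-number twist transfer `E_N(ℚ) → E(H)`, `(x, y) ↦ (x/θ², y/θ³)` (`θ = √−N`), its image
# (Galois-twisted rationality ⟺ "`E(ℚ(√−N))⁻ ≅ E_N(ℚ)`"), and the rational `2`-torsion under it

Cell `bsd-monsky` (typer seat), kernel work K1 of `run/shared/lean/pub/bsd-monsky/lean/PLAN.md` (tier 2), first
blocks: the identification `Λ_N ≅ E^{(N)}(ℚ)` of Monsky 1990 Lemma 4.3 ("the composition of `φ : C ≈ E` with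
the map `(u, v) → (−u, v/i√N)`") and Tian 2014 Thm. 1.5 ("`E(ℚ(√m*))⁻ ≅ E^{(m)}(ℚ)`") in the tree's currency:
`E : y² = x³ − x` is `congruentNumberCurve 1`, `E_N : y² = x³ − N²x = congruentNumberCurve N` is its quadratic
twist by `−N` (PROVED as an equation identity), and the tree's untwisting isomorphism `untwistEquivAt` over a field
`H ∋ θ = √−N` gives `transferE N θ : E_N(ℚ) →+ E(H)`. MAIN RESULT (`exists_transferE_eq_of_forall_gal`): for `H/ℚ`
finite Galois, a point of `E(H)` fixed by every automorphism fixing `θ` and negated by every automorphism moving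
`θ` lies in the image — Galois descent of `X` and `Y/θ` (`IsGalois.mem_range_algebraMap_iff_fixed`). Also the
three rational `2`-torsion points `(0,0), (1,0), (−1,0)` of `E`, `2·(·) = 0`, and `(∓N, 0) ↦ (±1, 0)`.
Pure Mathlib + tree; nothing asserted.

[cite: Monsky1990MockHeegner, Def. 4.2 and Lemma 4.3 (p. 56)] [cite: Tian2014, Thm. 1.5 (arXiv:1210.8231 p0003 L25–L27)]
[cite: SilvermanAEC2009, X.5 Cor. 5.4] [folklore]
-/

noncomputable section

open scoped Classical

open WeierstrassCurve NumberField Literature.NumberTheory.EllipticCurves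
  Literature.NumberTheory.EllipticCurves.TianYuanZhang2017

namespace Literature.NumberTheory.EllipticCurves.Tian2014

/-! ## §1 The curve `E : y² = x³ − x` over a field `H`, its three rational `2`-torsion points, the twist transfer -/

section OverField

variable (H : Type) [Field H] [CharZero H]

/-- `E(H)`: the `H`-points of `E : y² = x³ − x = congruentNumberCurve 1`. [cite: Tian2014, §1 (arXiv:1210.8231 p0001 L20–L24)] -/
abbrev EPoint : Type := ((congruentNumberCurve 1).baseChange H).toAffine.Point

variable {H}

/-- The affine equation of `E` over `H`: `y² = x³ − x`. [cite: Tian2014, §1 (p0001 L20–L24)] -/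
theorem E_equation_iff (x y : H) :
    ((congruentNumberCurve 1).baseChange H).toAffine.Equation x y ↔ y ^ 2 = x ^ 3 - x := by
  rw [WeierstrassCurve.Affine.equation_iff]
  simp [congruentNumberCurve, WeierstrassCurve.baseChange, sub_eq_add_neg]

/-- Every solution of `y² = x³ − x` over a field of characteristic `0` is a nonsingular point (`Δ = 64 ≠ 0`).
[cite: Tian2014, §1 (p0001 L20–L24)] -/
theorem E_nonsingular_iff (x y : H) :
    ((congruentNumberCurve 1).baseChange H).toAffine.Nonsingular x y ↔ y ^ 2 = x ^ 3 - x := by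
  have hΔ : ((congruentNumberCurve 1).baseChange H).Δ ≠ 0 := by
    rw [WeierstrassCurve.baseChange, WeierstrassCurve.map_Δ, congruentNumberCurve_Δ]; norm_num
  rw [← WeierstrassCurve.Affine.equation_iff_nonsingular_of_Δ_ne_zero hΔ, E_equation_iff]

/-- `(0, 0) ∈ E[2]`. [cite: Tian2014, Thm. 2.8 (1) (p0011 L39–L40)] -/
def ptZero : EPoint H := .some (x := 0) (y := 0) ((E_nonsingular_iff 0 0).mpr (by ring))

/-- `(1, 0) ∈ E[2]`. [cite: Tian2014, Thm. 2.8 (2)–(3) (p0011 L41–L44)] -/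
def ptOne : EPoint H := .some (x := 1) (y := 0) ((E_nonsingular_iff 1 0).mpr (by ring))

/-- `(−1, 0) ∈ E[2]`. [cite: Tian2014, Thm. 2.8 (3) (p0011 L42–L44)] -/
def ptNegOne : EPoint H := .some (x := -1) (y := 0) ((E_nonsingular_iff (-1) 0).mpr (by ring))

end OverField

/-- `E_N : y² = x³ − N²x` IS the quadratic twist of `E : y² = x³ − x` by `−N` (as equations).
[cite: Tian2014, §1 (p0001 L24–L26: E^{(n)} the twist of E by n)] -/
theorem congruentNumberCurve_eq_quadraticTwist (N : ℕ) :
    congruentNumberCurve N = (congruentNumberCurve 1).quadraticTwist (-(N : ℚ)) := by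
  ext <;> simp [congruentNumberCurve, quadraticTwist, b₂, b₄, b₆]
  ring

/-- `E = congruentNumberCurve 1` has `a₁ = a₃ = 0` (instance plumbing for `untwistEquivAt`). [cite: Tian2014, §1 (p0001 L20–L24)] [folklore] -/
instance congruentNumberCurve_one_isCharNeTwoNF : (congruentNumberCurve 1).IsCharNeTwoNF := ⟨rfl, rfl⟩

/-- **The transfer `E_N(ℚ) →+ E(H)`, `(x, y) ↦ (x/θ², y/θ³)`**, for a field `H ⊇ ℚ` with a chosen square root
`θ` of `−N`: base change of `ℚ`-points followed by the tree's untwisting isomorphism `ι_θ`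
(Silverman AEC X.5 Cor. 5.4). Its image is `E(ℚ(θ))⁻ = {Q ∈ E(ℚ(θ)) : Q̄ = −Q}` — the "`E(ℚ(√−m))⁻ ≅ E^{(m)}(ℚ)`"
of the source. [cite: Tian2014, Thm. 1.5 (p0003 L25–L27: E(ℚ(√m*))⁻ ≅ E^{(m)}(ℚ))] [cite: SilvermanAEC2009, X.5 Cor. 5.4] -/
def transferE (N : ℕ) {H : Type} [Field H] [CharZero H] (θ : H)
    (hθ2 : θ ^ 2 = algebraMap ℚ H (-(N : ℚ))) (hθ : θ ≠ 0) :
    (congruentNumberCurve N).toAffine.Point →+ EPoint H :=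
  (untwistEquivAt (congruentNumberCurve 1) hθ2 hθ).toAddMonoidHom.comp
    ((W2.ιK ((congruentNumberCurve 1).quadraticTwist (-(N : ℚ))) H).comp
      (Affine.Point.congrEquiv (congruentNumberCurve_eq_quadraticTwist N)).toAddMonoidHom)

section TwoTorsionPoints

variable {H : Type} [Field H] [CharZero H]

/-- `2·(0,0) = 0` (`(0,0) ∈ E[2]`). [cite: Tian2014, Thm. 2.8 (1) (p0011 L39–L40)] -/
theorem two_nsmul_ptZero : (2 : ℕ) • (ptZero : EPoint H) = 0 := by
  rw [two_nsmul, ptZero]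
  exact WeierstrassCurve.Affine.Point.add_of_Y_eq rfl (by rw [negY_baseChange_of_isCharNeTwoNF']; ring)

/-- `2·(1,0) = 0` (`(1,0) ∈ E[2]`). [cite: Tian2014, Thm. 2.8 (2) (p0011 L41)] -/
theorem two_nsmul_ptOne : (2 : ℕ) • (ptOne : EPoint H) = 0 := by
  rw [two_nsmul, ptOne]
  exact WeierstrassCurve.Affine.Point.add_of_Y_eq rfl (by rw [negY_baseChange_of_isCharNeTwoNF']; ring)

/-- `2·(−1,0) = 0` (`(−1,0) ∈ E[2]`). [cite: Tian2014, Thm. 2.8 (3) (p0011 L42–L44)] -/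
theorem two_nsmul_ptNegOne : (2 : ℕ) • (ptNegOne : EPoint H) = 0 := by
  rw [two_nsmul, ptNegOne]
  exact WeierstrassCurve.Affine.Point.add_of_Y_eq rfl (by rw [negY_baseChange_of_isCharNeTwoNF']; ring)

end TwoTorsionPoints

/-! ## §K1.a The image of the transfer: Galois-twisted rationality (kernel work, bsd-monsky typer) -/

section TransferImage

variable (N : ℕ) {H : Type} [Field H] [CharZero H]

/-- Every `g ∈ Gal(H/ℚ)` sends a square root `θ` of `−N` to `±θ` (the two embeddings of `ℚ(√−N)`). [cite: Monsky1990MockHeegner, Def. 4.2 (p. 56)] -/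
theorem gal_sqrt_eq_or_eq_neg (θ : H) (hθ2 : θ ^ 2 = algebraMap ℚ H (-(N : ℚ))) (g : H ≃ₐ[ℚ] H) :
    g θ = θ ∨ g θ = -θ := by
  have : (g θ) ^ 2 = θ ^ 2 := by rw [← map_pow, hθ2, AlgEquiv.commutes]
  exact sq_eq_sq_iff_eq_or_eq_neg.mp this

/-- The base change `ι : V(ℚ) → V(H)` of a `ℚ`-curve on an affine point (unfolding of `W2.ιK`). [cite: SilvermanAEC2009, X.5 Cor. 5.4] [folklore] -/
theorem ιK_some (W : WeierstrassCurve ℚ) {x y : ℚ} (h : W.toAffine.Nonsingular x y) :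
    ∃ h', W2.ιK W H (.some x y h) = .some (algebraMap ℚ H x) (algebraMap ℚ H y) h' :=
  ⟨_, rfl⟩

variable [FiniteDimensional ℚ H] [IsGalois ℚ H]

/-- **A point of `E(H)` is the transfer of a rational point of `E_N` as soon as it is fixed by every `g`
fixing `θ = √−N` and negated by every `g` sending `θ` to `−θ`** ("rational over `ℚ(√−N)` and transformed into
its negative by conjugation", Monsky Def. 4.2; "`E(ℚ(√−m))⁻`", Tian Thm. 1.5). Galois descent of the
coordinates: `X` and `Y/θ` are fixed by all of `Gal(H/ℚ)`, hence rational (`IsGalois.mem_range_algebraMap_iff_fixed`).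
[cite: Monsky1990MockHeegner, Def. 4.2 (p. 56), Lemma 4.3 (p. 56)] [cite: Tian2014, Thm. 1.5 (p0003 L25–L27)] -/
theorem exists_transferE_eq_of_forall_gal (θ : H) (hθ2 : θ ^ 2 = algebraMap ℚ H (-(N : ℚ))) (hθ : θ ≠ 0)
    (P : EPoint H)
    (hfix : ∀ g : H ≃ₐ[ℚ] H, g θ = θ →
      WeierstrassCurve.Affine.Point.map (W' := congruentNumberCurve 1) g.toAlgHom P = P)
    (hneg : ∀ g : H ≃ₐ[ℚ] H, g θ = -θ →
      WeierstrassCurve.Affine.Point.map (W' := congruentNumberCurve 1) g.toAlgHom P = -P) :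
    ∃ y' : (congruentNumberCurve N).toAffine.Point, transferE N θ hθ2 hθ y' = P := by
  rcases P with _ | ⟨X, Y, h⟩
  · exact ⟨0, map_zero _⟩
  -- the coordinates `X` and `Y/θ` are fixed by the whole Galois group
  have hX : ∀ g : H ≃ₐ[ℚ] H, g X = X := by
    intro g
    rcases gal_sqrt_eq_or_eq_neg N θ hθ2 g with hg | hg
    · have := hfix g hg
      rw [WeierstrassCurve.Affine.Point.map_some] at this
      exact (WeierstrassCurve.Affine.Point.some.inj this).1
    · have := hneg g hg
      rw [WeierstrassCurve.Affine.Point.map_some, WeierstrassCurve.Affine.Point.neg_some] at this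
      exact (WeierstrassCurve.Affine.Point.some.inj this).1
  have hY : ∀ g : H ≃ₐ[ℚ] H, g (Y / θ) = Y / θ := by
    intro g
    rcases gal_sqrt_eq_or_eq_neg N θ hθ2 g with hg | hg
    · have := hfix g hg
      rw [WeierstrassCurve.Affine.Point.map_some] at this
      have h1 : g Y = Y := (WeierstrassCurve.Affine.Point.some.inj this).2
      rw [map_div₀, hg, h1]
    · have := hneg g hg
      rw [WeierstrassCurve.Affine.Point.map_some, WeierstrassCurve.Affine.Point.neg_some] at this
      have h2 : g Y = -Y := by
        have := (WeierstrassCurve.Affine.Point.some.inj this).2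
        rwa [negY_baseChange_of_isCharNeTwoNF'] at this
      rw [map_div₀, hg, h2, neg_div_neg_eq]
  obtain ⟨x₀, hx₀⟩ := (IsGalois.mem_range_algebraMap_iff_fixed X).mpr hX
  obtain ⟨y₀, hy₀⟩ := (IsGalois.mem_range_algebraMap_iff_fixed (Y / θ)).mpr hY
  have hYθ : Y = θ * algebraMap ℚ H y₀ := by rw [hy₀]; field_simp
  -- the preimage of the point under the untwisting isomorphism has rational coordinates
  obtain ⟨P', hP'e⟩ : ∃ P', untwistEquivAt (congruentNumberCurve 1) hθ2 hθ P' = .some X Y h :=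
    ⟨_, (untwistEquivAt (congruentNumberCurve 1) hθ2 hθ).apply_symm_apply _⟩
  rcases P' with _ | ⟨x', y', h'⟩
  · exfalso
    have h0 : untwistEquivAt (congruentNumberCurve 1) hθ2 hθ 0 = .some X Y h := hP'e
    rw [map_zero] at h0
    exact WeierstrassCurve.Affine.Point.some_ne_zero _ h0.symm
  obtain ⟨h'', he'⟩ := untwistEquivAt_some (congruentNumberCurve 1) hθ2 hθ h'
  have hxy := hP'e
  rw [he'] at hxy
  obtain ⟨hx', hy'⟩ := WeierstrassCurve.Affine.Point.some.inj hxy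
  -- `x' = θ² X = −N x₀`, `y' = θ³ Y = N² y₀` are rational
  have hx'' : x' = algebraMap ℚ H (-(N : ℚ) * x₀) := by
    have : x' = θ ^ 2 * X := by
      rw [← hx']; field_simp
    rw [this, hθ2, ← hx₀, map_mul]
  have hy'' : y' = algebraMap ℚ H ((N : ℚ) ^ 2 * y₀) := by
    have : y' = θ ^ 3 * Y := by
      rw [← hy']; field_simp
    rw [this, hYθ, show θ ^ 3 * (θ * algebraMap ℚ H y₀) = (θ ^ 2) ^ 2 * algebraMap ℚ H y₀ by ring, hθ2,
      map_mul, map_pow, map_neg, neg_sq]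
  subst hx'' hy''
  -- descend nonsingularity to `ℚ`
  have hQ : ((congruentNumberCurve 1).quadraticTwist (-(N : ℚ))).toAffine.Nonsingular
      (-(N : ℚ) * x₀) ((N : ℚ) ^ 2 * y₀) :=
    (WeierstrassCurve.Affine.baseChange_nonsingular (W := (congruentNumberCurve 1).quadraticTwist (-(N : ℚ)))
      (f := Algebra.ofId ℚ H) (Algebra.ofId ℚ H).injective _ _).mp h'
  refine ⟨(WeierstrassCurve.Affine.Point.congrEquiv (congruentNumberCurve_eq_quadraticTwist N)).symm
    (.some _ _ hQ), ?_⟩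
  simp only [transferE, AddMonoidHom.comp_apply, AddEquiv.coe_toAddMonoidHom, AddEquiv.apply_symm_apply]
  obtain ⟨hQ', hι⟩ := ιK_some (H := H) _ hQ
  rw [hι]
  exact hP'e

end TransferImage

/-! ## §K1.d The rational `2`-torsion of `E_N` under the transfer, and Monsky Thm. 4.7 for EVERY transversal -/

section TwoTorsionTransfer

/-- `(±N, 0)` are points of `E_N : y² = x³ − N²x` (`N ≠ 0`): the rational `2`-torsion `E_N(ℚ)[2] = {O, (0,0), (±N,0)}`. [cite: Monsky1990MockHeegner, p. 45 ("`E^{(N)}_ℚ` has torsion `ℤ/2 × ℤ/2`")] -/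
theorem nonsingular_pm_N (N : ℕ) (hN : N ≠ 0) (s : ℚ) (hs : s = 1 ∨ s = -1) :
    (congruentNumberCurve N).toAffine.Nonsingular (s * (N : ℚ)) 0 := by
  have hΔ : (congruentNumberCurve N).Δ ≠ 0 := by
    rw [congruentNumberCurve_Δ]; exact mul_ne_zero (by norm_num) (pow_ne_zero _ (by exact_mod_cast hN))
  rw [← WeierstrassCurve.Affine.equation_iff_nonsingular_of_Δ_ne_zero hΔ,
    WeierstrassCurve.Affine.equation_iff]
  have hs2 : s ^ 2 = 1 := by rcases hs with rfl | rfl <;> norm_num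
  simp only [congruentNumberCurve]
  linear_combination (-(s * (N : ℚ) ^ 3)) * hs2

/-- The rational point `(−N, 0)` of `E_N`. [cite: Monsky1990MockHeegner, p. 45] -/
def twoTorsionNegN (N : ℕ) (hN : N ≠ 0) : (congruentNumberCurve N).toAffine.Point :=
  .some (x := (-1 : ℚ) * (N : ℚ)) (y := 0) (nonsingular_pm_N N hN (-1) (Or.inr rfl))

/-- The rational point `(N, 0)` of `E_N`. [cite: Monsky1990MockHeegner, p. 45] -/
def twoTorsionPosN (N : ℕ) (hN : N ≠ 0) : (congruentNumberCurve N).toAffine.Point :=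
  .some (x := (1 : ℚ) * (N : ℚ)) (y := 0) (nonsingular_pm_N N hN 1 (Or.inl rfl))

variable (N : ℕ) {H : Type} [Field H] [CharZero H]

/-- `(s·N, 0) ↦ (−s, 0)` under the transfer (`s = ±1`): `(−N, 0) ↦ (1, 0)`, `(N, 0) ↦ (−1, 0)` — the `2`-torsion `T ⊂ Λ_N` of Monsky under `Λ_N ≅ E^{(N)}(ℚ)`. [cite: Monsky1990MockHeegner, Lemma 4.3 (p. 56)] -/
theorem transferE_some_pm_N (hN : N ≠ 0) (θ : H) (hθ2 : θ ^ 2 = algebraMap ℚ H (-(N : ℚ))) (hθ : θ ≠ 0)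
    (s : ℚ) (hs : s = 1 ∨ s = -1) :
    transferE N θ hθ2 hθ (.some _ _ (nonsingular_pm_N N hN s hs)) =
      .some (-(algebraMap ℚ H s)) 0 (by
        rw [E_nonsingular_iff]
        have hs2 : (algebraMap ℚ H s) ^ 2 = 1 := by
          rcases hs with rfl | rfl <;> simp
        linear_combination (algebraMap ℚ H s) * hs2) := by
  simp only [transferE, AddMonoidHom.comp_apply, AddEquiv.coe_toAddMonoidHom]
  rw [WeierstrassCurve.Affine.Point.congrEquiv_some]
  obtain ⟨h'', hι⟩ := ιK_some (H := H) _ (congruentNumberCurve_eq_quadraticTwist N ▸ nonsingular_pm_N N hN s hs)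
  rw [hι]
  obtain ⟨h3, he⟩ := untwistEquivAt_some (congruentNumberCurve 1) hθ2 hθ h''
  rw [he]
  simp only [WeierstrassCurve.Affine.Point.some.injEq]
  have hθ2' : θ ^ 2 ≠ 0 := pow_ne_zero 2 hθ
  refine ⟨?_, by simp⟩
  rw [map_mul, map_natCast]
  have hN' : (N : H) = -(θ ^ 2) := by rw [hθ2, map_neg, map_natCast, neg_neg]
  rw [hN', mul_neg, mul_comm, neg_mul, mul_assoc, mul_inv_cancel₀ hθ2', mul_one]

/-- `(−N, 0) ↦ (1, 0)` under the transfer. [cite: Monsky1990MockHeegner, Lemma 4.3 (p. 56)] -/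
theorem transferE_twoTorsionNegN (hN : N ≠ 0) (θ : H) (hθ2 : θ ^ 2 = algebraMap ℚ H (-(N : ℚ)))
    (hθ : θ ≠ 0) : transferE N θ hθ2 hθ (twoTorsionNegN N hN) = ptOne := by
  rw [twoTorsionNegN, transferE_some_pm_N N hN θ hθ2 hθ (-1) (Or.inr rfl), ptOne]
  simp

/-- `(N, 0) ↦ (−1, 0)` under the transfer. [cite: Monsky1990MockHeegner, Lemma 4.3 (p. 56)] -/
theorem transferE_twoTorsionPosN (hN : N ≠ 0) (θ : H) (hθ2 : θ ^ 2 = algebraMap ℚ H (-(N : ℚ)))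
    (hθ : θ ≠ 0) : transferE N θ hθ2 hθ (twoTorsionPosN N hN) = ptNegOne := by
  rw [twoTorsionPosN, transferE_some_pm_N N hN θ hθ2 hθ 1 (Or.inl rfl), ptNegOne]
  simp

end TwoTorsionTransfer

end Literature.NumberTheory.EllipticCurves.Tian2014

end
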